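import Literature.NumberTheory.ComplexMultiplication.CMOrderCohenMacaulayTypeGlobal
import HarnessLib

/-!
# An order with a maximal ideal `𝔓` that is an `𝒪_K`-ideal — the orders `T = S + 𝔭𝒪_K` of MARSEGLIA 2024
# PROPOSITION 4.5: `𝔓 = (T:𝒪_K)` is the unique non-invertible prime, `(𝔓:𝔓) = 𝒪_K`, and
# `type(T) + 1 = type_𝔓(T) + 1 = dim_{T/𝔓} 𝒪_K/𝔓`

Family `hodge`, lane `lit-hodgefound` (Track 2 foundations library; seat p15, row g28-#6), topic
`Literature/NumberTheory/ComplexMultiplication`, namespace `Literature.NumberTheory.ComplexMultiplication.CMTypeLattice`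
(the order `𝔯 = endOrder (M_μ)` of a `ℚ`-basis `μ` of a number field `K`; the maximal order `𝒪_K` is the idempotent
fractional `𝔯`-ideal `M` with `↑M = range (algebraMap (𝓞 K) K)` (`EndOrder.exists_idempotent_coe_eq_range`); an
ideal `𝔓` of `𝔯` «is an `𝒪_K`-ideal» when `M·↑𝔓 = ↑𝔓` (`EndOrder.mul_eq_iff_forall_mul_mem_of_coe_eq_range`);
«`𝔯 ≠ 𝒪_K`» is `∃ a : 𝓞 K, (a : K) ∉ 𝔯` (`EndOrder.conductorIdeal_eq_top_iff`); the local type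
`type_𝔭(𝔯) = finrank (𝔯 ⧸ 𝔭) (↥↑T ⧸ 𝔭 • ⊤)` with `↑T = traceDual ℤ ℚ ↑1` and the global type `⨆ 𝔭, type_𝔭(𝔯)`
(`CMOrderCohenMacaulayTypeOne`, `CMOrderCohenMacaulayTypeGlobal`); `𝒪_K/𝔓 = 𝒪_K/𝔓𝒪_K` is the `𝔯/𝔓`-space
`↥↑M ⧸ 𝔓 • ⊤`).  THEOREMS ONLY: no definition, no instance, no named fact (net Literature debt `0`).

SCOPE.  PROPOSITION 4.5 starts from an arbitrary order `S` and a prime `𝔭`, and passes to the over-order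
`T = S + 𝔭𝒪_K` and its prime `𝔓 = 𝔭𝒪_K` with `T/𝔓 = S/𝔭` (4.1).  Everything the printed proof then establishes is
a statement about the single order `T` and its maximal ideal `𝔓`, which is an `𝒪_K`-ideal; this file proves those
statements for ANY order `𝔯` of the tree's form with such a maximal ideal (the case `𝔯 = ℤ + p𝒪_K`, `𝔓 = p𝒪_K` is
`CMOrderCohenMacaulayTypeAttained`).  The construction of `S + 𝔭𝒪_K` as an `endOrder (M_ν)` over a given
`S = endOrder (M_μ)` and the identification (4.1) across the two base rings are NOT in this file.

## Source, VERBATIM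

S. Marseglia, *Cohen-Macaulay type of orders, generators and ideal classes*, J. Algebra 658 (2024) 247–276
[Marseglia2024CMType] (arXiv:2206.03758, held `paper:arxiv-2206.03758`), §4, chunk p0010:

> "Proposition 4.5. Let `𝔭` be a prime of an order `S`. Then `dim_{S/𝔭} 𝒪_K/𝔭𝒪_K = 1` if `𝔭` is invertible,
> `1 + type_𝔓(S + 𝔭𝒪_K)` otherwise. […] Proof. Put `𝔓 = 𝔭𝒪_K` and consider the overorder `T = S + 𝔓` of `S`.
> Observe that we have inclusions `𝔭 ⊆ S ∩ 𝔓 ⊆ S`. Since `1` is not in `𝔓`, we have the equality `𝔭 = S ∩ 𝔓`.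
> Hence `T/𝔓 = (S + 𝔓)/𝔓 ≃ S/(S ∩ 𝔓) = S/𝔭` (4.1), which, in particular, shows that `𝔓` is a prime of `T`. Note that
> `(𝔓:𝔓) = 𝒪_K` and so `𝒪_K/𝔭𝒪_K = 𝒪_K/𝔓 = (𝔓:𝔓)/𝔓` (4.2). We already know by Lemma 2.14.(i) that `𝔭` is
> invertible if and only if `𝒪_K/𝔭𝒪_K` has dimension `1` over `S/𝔭`. So we assume that `𝔭` is not invertible. If
> `𝔓` were invertible then by Lemma 2.x we would have `(𝔓:𝔓) = T`. Hence by Equations (4.1) and (4.2) we would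
> have that `𝒪_K/𝔭𝒪_K` has dimension `1` as a vector space over `S/𝔭`. Hence `𝔓` is not invertible. So we can
> apply Proposition 3.5 which gives us the first equality in `type_𝔓(T) + 1 = dim_{T/𝔓} (𝔓:𝔓)/𝔓 =
> dim_{S/𝔭} 𝒪_K/𝔭𝒪_K`, while the last equality is given by Equations (4.1) and (4.2). To conclude the proof we
> need to show that `type_𝔓(T) = type(T)`. Note that `𝔓` is a fractional `𝒪_K`-ideal inside `T`. So `𝔓` is
> contained in the conductor `(T:𝒪_K)`, which is a proper ideal since `𝔓` is not invertible. Hence `𝔓 = (T:𝒪_K)`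
> by maximality of `𝔓`. By Lemma 2.14.(i) we have that `𝔓` is the only non invertible ideal of `T`. Proposition 3.3
> shows then that the only contribution to the global type of `T` comes from `𝔓`, that is, `type_𝔓(T) = type(T)`."

## What is formalised (the printed proof, step by step, for the order `T = 𝔯` and its maximal `𝒪_K`-ideal `𝔓`)

* §1 «`𝔓` is contained in the conductor `(T:𝒪_K)`» (`le_conductorIdeal_of_mul_coeIdeal_eq`); «`𝔓 = (T:𝒪_K)` by
  maximality of `𝔓`» when `T ≠ 𝒪_K` (`conductorIdeal_eq_of_mul_coeIdeal_eq`); «`𝔓` is not invertible»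
  (`not_isUnit_coeIdeal_of_mul_coeIdeal_eq`) — indeed `𝔓` is invertible iff `T = 𝒪_K`
  (`isUnit_coeIdeal_iff_forall_coe_mem_of_mul_coeIdeal_eq`); «`𝔓` is the only non invertible ideal of `T`»
  (`eq_of_not_isUnit_coeIdeal_of_mul_coeIdeal_eq`, `not_isUnit_coeIdeal_iff_eq_of_mul_coeIdeal_eq`).
* §2 «`(𝔓:𝔓) = 𝒪_K`», eq. (4.2) (`coeIdeal_div_self_eq_of_mul_coeIdeal_eq`, for every nonzero `𝒪_K`-ideal `𝔓`
  of `𝔯`); **PROPOSITION 4.5, second case: `finrank_traceDual_quotient_add_one_eq_finrank_quotient_of_mul_coeIdeal_eq`,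
  `type_𝔓(T) + 1 = dim_{T/𝔓} 𝒪_K/𝔓`** (PROPOSITION 3.5 of `CMOrderCohenMacaulayTypeBound` for the non-invertible
  `𝔓`, and (4.2)); PROPOSITION 4.5, first case / LEMMA 2.14 (i) read on `T`: `dim_{T/𝔓} 𝒪_K/𝔓 = 1 ⟺ T = 𝒪_K`
  (`finrank_quotient_eq_one_iff_forall_coe_mem_of_mul_coeIdeal_eq`).
* §3 «the only contribution to the global type of `T` comes from `𝔓`»: `type_𝔮(T) = 1` for `𝔮 ≠ 𝔓`
  (`finrank_traceDual_quotient_eq_one_of_ne_of_mul_coeIdeal_eq`), **`iSup_finrank_traceDual_quotient_eq_of_mul_coeIdeal_eq`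
  (`type(T) = type_𝔓(T)`)** and **`iSup_finrank_traceDual_quotient_add_one_eq_finrank_quotient_of_mul_coeIdeal_eq`
  (`type(T) + 1 = dim_{T/𝔓} 𝒪_K/𝔓`)**.
-/

noncomputable section

open scoped nonZeroDivisors NumberField
open NumberField Module FractionalIdeal
open Submodule (traceDual)

namespace Literature.NumberTheory.ComplexMultiplication

namespace CMTypeLattice

variable {K : Type} [Field K] [NumberField K]
variable {ι : Type} [Fintype ι] [DecidableEq ι] (μ : Basis ι ℚ K) [Nonempty ι]
variable [IsFractionRing (endOrder (Algebra.leftMulMatrix μ)) K]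

/-! ## §1 The maximal `𝒪_K`-ideal `𝔓` is the conductor and the unique non-invertible prime -/

omit [IsFractionRing (endOrder (Algebra.leftMulMatrix μ)) K] in
/-- **«`𝔓` is a fractional `𝒪_K`-ideal inside `T`. So `𝔓` is contained in the conductor `(T:𝒪_K)`»**: an ideal
`𝔓` of `𝔯` with `𝒪_K·𝔓 = 𝔓` lies in `𝔣 = {x : x𝒪_K ⊆ 𝔯}`. [cite: Marseglia2024CMType, §4 Prop. 4.5 (proof), p. 10] -/
theorem le_conductorIdeal_of_mul_coeIdeal_eq {M : FractionalIdeal (endOrder (Algebra.leftMulMatrix μ))⁰ K}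
    (hMO : (M : Set K) = (algebraMap (𝓞 K) K).range) {𝔓 : Ideal (endOrder (Algebra.leftMulMatrix μ))}
    (h𝔓M : M * 𝔓 = 𝔓) : 𝔓 ≤ EndOrder.conductorIdeal (Algebra.leftMulMatrix μ) := by
  intro r hr
  rw [EndOrder.mem_conductorIdeal_iff]
  intro y
  have hrP : (r : K) ∈ (𝔓 : FractionalIdeal (endOrder (Algebra.leftMulMatrix μ))⁰ K) :=
    (mem_coeIdeal _).2 ⟨r, hr, rfl⟩
  have h := (EndOrder.mul_eq_iff_forall_mul_mem_of_coe_eq_range hMO).1 h𝔓M y (r : K) hrP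
  obtain ⟨r', -, hr'⟩ := (mem_coeIdeal _).1 h
  rw [mul_comm, ← hr']
  exact r'.2

omit [IsFractionRing (endOrder (Algebra.leftMulMatrix μ)) K] in
/-- A maximal ideal of the order `𝔯` is nonzero (`𝔯` is not a field). [cite: Marseglia2024CMType, §2.4 Lemma 2.7, p. 6] -/
theorem ne_bot_of_isMaximal {𝔓 : Ideal (endOrder (Algebra.leftMulMatrix μ))} (h𝔓 : 𝔓.IsMaximal) : 𝔓 ≠ ⊥ :=
  Ring.ne_bot_of_isMaximal_of_not_isField h𝔓 EndOrder.not_isField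

omit [IsFractionRing (endOrder (Algebra.leftMulMatrix μ)) K] in
/-- **«the conductor `(T:𝒪_K)` is a proper ideal […]. Hence `𝔓 = (T:𝒪_K)` by maximality of `𝔓`»**: for an order
`𝔯 ≠ 𝒪_K`, a maximal ideal which is an `𝒪_K`-ideal IS the conductor. [cite: Marseglia2024CMType, §4 Prop. 4.5
(proof), p. 10] -/
theorem conductorIdeal_eq_of_mul_coeIdeal_eq {M : FractionalIdeal (endOrder (Algebra.leftMulMatrix μ))⁰ K}
    (hMO : (M : Set K) = (algebraMap (𝓞 K) K).range) {𝔓 : Ideal (endOrder (Algebra.leftMulMatrix μ))}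
    [h𝔓 : 𝔓.IsMaximal] (h𝔓M : M * 𝔓 = 𝔓) (hS : ∃ a : 𝓞 K, (a : K) ∉ endOrder (Algebra.leftMulMatrix μ)) :
    EndOrder.conductorIdeal (Algebra.leftMulMatrix μ) = 𝔓 := by
  obtain ⟨a, ha⟩ := hS
  have hne : EndOrder.conductorIdeal (Algebra.leftMulMatrix μ) ≠ ⊤ := fun h ↦
    ha ((EndOrder.conductorIdeal_eq_top_iff (ρ := Algebra.leftMulMatrix μ)).1 h a)
  exact (h𝔓.eq_of_le hne (le_conductorIdeal_of_mul_coeIdeal_eq μ hMO h𝔓M)).symm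

/-- **«Hence `𝔓` is not invertible»**: a maximal `𝒪_K`-ideal of an order `𝔯 ≠ 𝒪_K` is not an invertible `𝔯`-ideal
(it contains the conductor). [cite: Marseglia2024CMType, §4 Prop. 4.5 (proof), p. 10; §2.5 Lemma 2.14 (i), p. 7] -/
theorem not_isUnit_coeIdeal_of_mul_coeIdeal_eq {M : FractionalIdeal (endOrder (Algebra.leftMulMatrix μ))⁰ K}
    (hMO : (M : Set K) = (algebraMap (𝓞 K) K).range) {𝔓 : Ideal (endOrder (Algebra.leftMulMatrix μ))}
    [h𝔓 : 𝔓.IsMaximal] (h𝔓M : M * 𝔓 = 𝔓) (hS : ∃ a : 𝓞 K, (a : K) ∉ endOrder (Algebra.leftMulMatrix μ)) :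
    ¬ IsUnit (𝔓 : FractionalIdeal (endOrder (Algebra.leftMulMatrix μ))⁰ K) :=
  (EndOrder.not_isUnit_coeIdeal_iff_conductorIdeal_le h𝔓.isPrime (ne_bot_of_isMaximal μ h𝔓)).2
    (conductorIdeal_eq_of_mul_coeIdeal_eq μ hMO h𝔓M hS).le

/-- **A maximal `𝒪_K`-ideal `𝔓` of `𝔯` is invertible iff `𝔯 = 𝒪_K`** (if `𝔯 = 𝒪_K` every prime is invertible; if
not, `𝔓` is the conductor). [cite: Marseglia2024CMType, §4 Prop. 4.5 (proof: «If `𝔓` were invertible then […]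
`(𝔓:𝔓) = T`»), p. 10; §2.5 Lemma 2.14 (i), p. 7] -/
theorem isUnit_coeIdeal_iff_forall_coe_mem_of_mul_coeIdeal_eq
    {M : FractionalIdeal (endOrder (Algebra.leftMulMatrix μ))⁰ K}
    (hMO : (M : Set K) = (algebraMap (𝓞 K) K).range) {𝔓 : Ideal (endOrder (Algebra.leftMulMatrix μ))}
    [h𝔓 : 𝔓.IsMaximal] (h𝔓M : M * 𝔓 = 𝔓) :
    IsUnit (𝔓 : FractionalIdeal (endOrder (Algebra.leftMulMatrix μ))⁰ K) ↔
      ∀ a : 𝓞 K, (a : K) ∈ endOrder (Algebra.leftMulMatrix μ) := by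
  constructor
  · intro hu
    by_contra hall
    push Not at hall
    exact not_isUnit_coeIdeal_of_mul_coeIdeal_eq μ hMO h𝔓M hall hu
  · intro hall
    refine (EndOrder.isUnit_coeIdeal_iff_not_conductorIdeal_le h𝔓.isPrime (ne_bot_of_isMaximal μ h𝔓)).2
      fun hle ↦ h𝔓.ne_top (top_le_iff.1 ?_)
    exact ((EndOrder.conductorIdeal_eq_top_iff (ρ := Algebra.leftMulMatrix μ)).2 hall).symm.trans_le hle

/-- **«By Lemma 2.14.(i) we have that `𝔓` is the only non invertible ideal of `T`»**: for an order `𝔯 ≠ 𝒪_K` with a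
maximal `𝒪_K`-ideal `𝔓`, every non-invertible nonzero prime equals `𝔓`. [cite: Marseglia2024CMType, §4 Prop. 4.5
(proof), p. 10; §2.5 Lemma 2.14 (i), p. 7] -/
theorem eq_of_not_isUnit_coeIdeal_of_mul_coeIdeal_eq {M : FractionalIdeal (endOrder (Algebra.leftMulMatrix μ))⁰ K}
    (hMO : (M : Set K) = (algebraMap (𝓞 K) K).range) {𝔓 : Ideal (endOrder (Algebra.leftMulMatrix μ))}
    [h𝔓 : 𝔓.IsMaximal] (h𝔓M : M * 𝔓 = 𝔓) (hS : ∃ a : 𝓞 K, (a : K) ∉ endOrder (Algebra.leftMulMatrix μ))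
    {𝔮 : Ideal (endOrder (Algebra.leftMulMatrix μ))} [h𝔮 : 𝔮.IsPrime] (hq0 : 𝔮 ≠ ⊥)
    (hu : ¬ IsUnit (𝔮 : FractionalIdeal (endOrder (Algebra.leftMulMatrix μ))⁰ K)) : 𝔮 = 𝔓 := by
  rw [EndOrder.not_isUnit_coeIdeal_iff_conductorIdeal_le h𝔮 hq0,
    conductorIdeal_eq_of_mul_coeIdeal_eq μ hMO h𝔓M hS] at hu
  exact (h𝔓.eq_of_le h𝔮.ne_top hu).symm

/-- **The non-invertible nonzero primes of such an order are exactly `{𝔓}`.** [cite: Marseglia2024CMType, §4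
Prop. 4.5 (proof), p. 10; §2.5 Lemma 2.14 (i), p. 7] -/
theorem not_isUnit_coeIdeal_iff_eq_of_mul_coeIdeal_eq {M : FractionalIdeal (endOrder (Algebra.leftMulMatrix μ))⁰ K}
    (hMO : (M : Set K) = (algebraMap (𝓞 K) K).range) {𝔓 : Ideal (endOrder (Algebra.leftMulMatrix μ))}
    [h𝔓 : 𝔓.IsMaximal] (h𝔓M : M * 𝔓 = 𝔓) (hS : ∃ a : 𝓞 K, (a : K) ∉ endOrder (Algebra.leftMulMatrix μ))
    {𝔮 : Ideal (endOrder (Algebra.leftMulMatrix μ))} [h𝔮 : 𝔮.IsPrime] (hq0 : 𝔮 ≠ ⊥) :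
    ¬ IsUnit (𝔮 : FractionalIdeal (endOrder (Algebra.leftMulMatrix μ))⁰ K) ↔ 𝔮 = 𝔓 := by
  refine ⟨eq_of_not_isUnit_coeIdeal_of_mul_coeIdeal_eq μ hMO h𝔓M hS hq0, ?_⟩
  rintro rfl
  exact not_isUnit_coeIdeal_of_mul_coeIdeal_eq μ hMO h𝔓M hS

/-! ## §2 «`(𝔓:𝔓) = 𝒪_K`» (4.2) and PROPOSITION 4.5: `type_𝔓(T) + 1 = dim_{T/𝔓} 𝒪_K/𝔓` -/

/-- **«Note that `(𝔓:𝔓) = 𝒪_K`», eq. (4.2): the multiplicator ring of a nonzero `𝒪_K`-ideal `𝔓` of `𝔯` is `𝒪_K`**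
(`𝔓` is an invertible `𝒪_K`-ideal, `𝒪_K` being Dedekind; `EndOrder.exists_mul_eq_of_coe_eq_range`,
`EndOrder.div_self_eq_of_mul_eq_overorder`). [cite: Marseglia2024CMType, §4 Prop. 4.5 (proof, (4.2)), p. 10] -/
theorem coeIdeal_div_self_eq_of_mul_coeIdeal_eq {M : FractionalIdeal (endOrder (Algebra.leftMulMatrix μ))⁰ K}
    (hMO : (M : Set K) = (algebraMap (𝓞 K) K).range) {𝔓 : Ideal (endOrder (Algebra.leftMulMatrix μ))}
    (h𝔓M : M * 𝔓 = 𝔓) (h0 : 𝔓 ≠ ⊥) :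
    (𝔓 : FractionalIdeal (endOrder (Algebra.leftMulMatrix μ))⁰ K) / 𝔓 = M := by
  obtain ⟨hMMle, h1⟩ := EndOrder.mul_self_le_and_one_mem_of_coe_eq_range hMO
  have hMM := EndOrder.mul_self_eq_of_one_mem_of_mul_self_le h1 hMMle
  have hM0 : M ≠ 0 := fun h ↦ by
    rw [h] at h1
    exact one_ne_zero ((mem_zero_iff _).1 h1)
  obtain ⟨N', -, hN'⟩ := EndOrder.exists_mul_eq_of_coe_eq_range hMO (coeIdeal_ne_zero.2 h0) h𝔓M
  exact EndOrder.div_self_eq_of_mul_eq_overorder hMM hM0 h𝔓M hN'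

/-- **MARSEGLIA 2024 PROPOSITION 4.5 (the non-invertible case, on the order `T`): `type_𝔓(T) + 1 = dim_{T/𝔓} 𝒪_K/𝔓`**
for an order `T = 𝔯 ≠ 𝒪_K` and a maximal ideal `𝔓` which is an `𝒪_K`-ideal — «we can apply Proposition 3.5 which
gives us `type_𝔓(T) + 1 = dim_{T/𝔓} (𝔓:𝔓)/𝔓`» and `(𝔓:𝔓)/𝔓 = 𝒪_K/𝔓` by (4.2); here `𝒪_K/𝔓 = 𝒪_K/𝔓𝒪_K` is
`↥↑M ⧸ 𝔓 • ⊤`. [cite: Marseglia2024CMType, §4 Prop. 4.5, p. 10; §3 Prop. 3.5, p. 9] -/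
theorem finrank_traceDual_quotient_add_one_eq_finrank_quotient_of_mul_coeIdeal_eq
    {M : FractionalIdeal (endOrder (Algebra.leftMulMatrix μ))⁰ K}
    (hMO : (M : Set K) = (algebraMap (𝓞 K) K).range) {𝔓 : Ideal (endOrder (Algebra.leftMulMatrix μ))}
    [h𝔓 : 𝔓.IsMaximal] (h𝔓M : M * 𝔓 = 𝔓) (hS : ∃ a : 𝓞 K, (a : K) ∉ endOrder (Algebra.leftMulMatrix μ))
    {T : FractionalIdeal (endOrder (Algebra.leftMulMatrix μ))⁰ K}
    (hT : (T : Submodule (endOrder (Algebra.leftMulMatrix μ)) K) =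
      traceDual ℤ ℚ ((1 : FractionalIdeal (endOrder (Algebra.leftMulMatrix μ))⁰ K) :
        Submodule (endOrder (Algebra.leftMulMatrix μ)) K)) :
    Module.finrank (endOrder (Algebra.leftMulMatrix μ) ⧸ 𝔓)
        ((T : Submodule (endOrder (Algebra.leftMulMatrix μ)) K) ⧸
          (𝔓 • ⊤ : Submodule (endOrder (Algebra.leftMulMatrix μ))
            (T : Submodule (endOrder (Algebra.leftMulMatrix μ)) K))) + 1 =
      Module.finrank (endOrder (Algebra.leftMulMatrix μ) ⧸ 𝔓)
        ((M : Submodule (endOrder (Algebra.leftMulMatrix μ)) K) ⧸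
          (𝔓 • ⊤ : Submodule (endOrder (Algebra.leftMulMatrix μ))
            (M : Submodule (endOrder (Algebra.leftMulMatrix μ)) K))) := by
  rw [← coeIdeal_div_self_eq_of_mul_coeIdeal_eq μ hMO h𝔓M (ne_bot_of_isMaximal μ h𝔓)]
  exact finrank_traceDual_quotient_add_one_eq μ hT 𝔓 (not_isUnit_coeIdeal_of_mul_coeIdeal_eq μ hMO h𝔓M hS)

/-- **PROPOSITION 4.5, first case / LEMMA 2.14 (i) on the order `T`: for a maximal `𝒪_K`-ideal `𝔓`,
`dim_{T/𝔓} 𝒪_K/𝔓 = 1 ⟺ T = 𝒪_K` (⟺ `𝔓` invertible)** — «`𝔭` is invertible if and only if `𝒪_K/𝔭𝒪_K` has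
dimension `1`». [cite: Marseglia2024CMType, §4 Prop. 4.5 (first case and proof), p. 10; §2.5 Lemma 2.14 (i), p. 7] -/
theorem finrank_quotient_eq_one_iff_forall_coe_mem_of_mul_coeIdeal_eq
    {M : FractionalIdeal (endOrder (Algebra.leftMulMatrix μ))⁰ K}
    (hMO : (M : Set K) = (algebraMap (𝓞 K) K).range) {𝔓 : Ideal (endOrder (Algebra.leftMulMatrix μ))}
    [h𝔓 : 𝔓.IsMaximal] (h𝔓M : M * 𝔓 = 𝔓) :
    Module.finrank (endOrder (Algebra.leftMulMatrix μ) ⧸ 𝔓)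
        ((M : Submodule (endOrder (Algebra.leftMulMatrix μ)) K) ⧸
          (𝔓 • ⊤ : Submodule (endOrder (Algebra.leftMulMatrix μ))
            (M : Submodule (endOrder (Algebra.leftMulMatrix μ)) K))) = 1 ↔
      ∀ a : 𝓞 K, (a : K) ∈ endOrder (Algebra.leftMulMatrix μ) := by
  have h0 := ne_bot_of_isMaximal μ h𝔓
  constructor
  · intro h1
    by_contra hall
    push Not at hall
    obtain ⟨T, -, hT⟩ := exists_coe_eq_traceDual μ
      (one_ne_zero' (FractionalIdeal (endOrder (Algebra.leftMulMatrix μ))⁰ K))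
    have h := finrank_traceDual_quotient_add_one_eq_finrank_quotient_of_mul_coeIdeal_eq μ hMO h𝔓M hall hT
    have hpos := finrank_traceDual_quotient_pos μ hT h0
    omega
  · intro hall
    haveI := h𝔓.isPrime
    refine (EndOrder.finrank_quotient_eq_one_iff_span_coe_eq_span_one_of_coe_eq_range hMO h0).2
      (EndOrder.span_coe_eq_span_one_of_coe_eq_range_of_not_conductorIdeal_le hMO fun hle ↦
        h𝔓.ne_top (top_le_iff.1 ?_))
    exact ((EndOrder.conductorIdeal_eq_top_iff (ρ := Algebra.leftMulMatrix μ)).2 hall).symm.trans_le hle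

/-! ## §3 «the only contribution to the global type of `T` comes from `𝔓`»: `type(T) = type_𝔓(T)` -/

/-- **At every other nonzero prime `𝔮 ≠ 𝔓` the type is `1`** (`𝔮` is invertible, PROPOSITION 3.3).
[cite: Marseglia2024CMType, §4 Prop. 4.5 (proof: «Proposition 3.3 shows then that the only contribution to the global
type of `T` comes from `𝔓`»), p. 10; §3 Prop. 3.3, p. 9] -/
theorem finrank_traceDual_quotient_eq_one_of_ne_of_mul_coeIdeal_eq
    {M : FractionalIdeal (endOrder (Algebra.leftMulMatrix μ))⁰ K}
    (hMO : (M : Set K) = (algebraMap (𝓞 K) K).range) {𝔓 : Ideal (endOrder (Algebra.leftMulMatrix μ))}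
    [h𝔓 : 𝔓.IsMaximal] (h𝔓M : M * 𝔓 = 𝔓) (hS : ∃ a : 𝓞 K, (a : K) ∉ endOrder (Algebra.leftMulMatrix μ))
    {T : FractionalIdeal (endOrder (Algebra.leftMulMatrix μ))⁰ K}
    (hT : (T : Submodule (endOrder (Algebra.leftMulMatrix μ)) K) =
      traceDual ℤ ℚ ((1 : FractionalIdeal (endOrder (Algebra.leftMulMatrix μ))⁰ K) :
        Submodule (endOrder (Algebra.leftMulMatrix μ)) K))
    {𝔮 : Ideal (endOrder (Algebra.leftMulMatrix μ))} [h𝔮 : 𝔮.IsPrime] (hq0 : 𝔮 ≠ ⊥) (hne : 𝔮 ≠ 𝔓) :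
    Module.finrank (endOrder (Algebra.leftMulMatrix μ) ⧸ 𝔮)
      ((T : Submodule (endOrder (Algebra.leftMulMatrix μ)) K) ⧸
        (𝔮 • ⊤ : Submodule (endOrder (Algebra.leftMulMatrix μ))
          (T : Submodule (endOrder (Algebra.leftMulMatrix μ)) K))) = 1 := by
  by_cases hu : IsUnit (𝔮 : FractionalIdeal (endOrder (Algebra.leftMulMatrix μ))⁰ K)
  · exact finrank_traceDual_quotient_eq_one_of_isUnit_coeIdeal μ hT hq0 hu
  · exact absurd (eq_of_not_isUnit_coeIdeal_of_mul_coeIdeal_eq μ hMO h𝔓M hS hq0 hu) hne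

/-- **«that is, `type_𝔓(T) = type(T)`»: the global type `max_𝔮 type_𝔮(T)` of such an order is its type at `𝔓`.**
[cite: Marseglia2024CMType, §4 Prop. 4.5 (proof), p. 10; §3 Def. 3.2 (ii), p. 9] -/
theorem iSup_finrank_traceDual_quotient_eq_of_mul_coeIdeal_eq
    {M : FractionalIdeal (endOrder (Algebra.leftMulMatrix μ))⁰ K}
    (hMO : (M : Set K) = (algebraMap (𝓞 K) K).range) {𝔓 : Ideal (endOrder (Algebra.leftMulMatrix μ))}
    [h𝔓 : 𝔓.IsMaximal] (h𝔓M : M * 𝔓 = 𝔓) (hS : ∃ a : 𝓞 K, (a : K) ∉ endOrder (Algebra.leftMulMatrix μ))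
    {T : FractionalIdeal (endOrder (Algebra.leftMulMatrix μ))⁰ K}
    (hT : (T : Submodule (endOrder (Algebra.leftMulMatrix μ)) K) =
      traceDual ℤ ℚ ((1 : FractionalIdeal (endOrder (Algebra.leftMulMatrix μ))⁰ K) :
        Submodule (endOrder (Algebra.leftMulMatrix μ)) K)) :
    ⨆ 𝔮 : MaximalSpectrum (endOrder (Algebra.leftMulMatrix μ)),
        Module.finrank (endOrder (Algebra.leftMulMatrix μ) ⧸ 𝔮.asIdeal)
          ((T : Submodule (endOrder (Algebra.leftMulMatrix μ)) K) ⧸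
            (𝔮.asIdeal • ⊤ : Submodule (endOrder (Algebra.leftMulMatrix μ))
              (T : Submodule (endOrder (Algebra.leftMulMatrix μ)) K))) =
      Module.finrank (endOrder (Algebra.leftMulMatrix μ) ⧸ 𝔓)
        ((T : Submodule (endOrder (Algebra.leftMulMatrix μ)) K) ⧸
          (𝔓 • ⊤ : Submodule (endOrder (Algebra.leftMulMatrix μ))
            (T : Submodule (endOrder (Algebra.leftMulMatrix μ)) K))) := by
  haveI : Nonempty (MaximalSpectrum (endOrder (Algebra.leftMulMatrix μ))) := ⟨⟨𝔓, h𝔓⟩⟩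
  refine le_antisymm (ciSup_le fun 𝔮 ↦ ?_) (le_ciSup (bddAbove_range_finrank_traceDual_quotient μ hT) ⟨𝔓, h𝔓⟩)
  by_cases h : 𝔮.asIdeal = 𝔓
  · have h' : 𝔮 = ⟨𝔓, h𝔓⟩ := MaximalSpectrum.ext h
    subst h'
    exact le_rfl
  · rw [finrank_traceDual_quotient_eq_one_of_ne_of_mul_coeIdeal_eq μ hMO h𝔓M hS hT (asIdeal_ne_bot μ 𝔮) h]
    exact Nat.one_le_iff_ne_zero.2 (finrank_traceDual_quotient_pos μ hT (ne_bot_of_isMaximal μ h𝔓)).ne'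

/-- **MARSEGLIA 2024 PROPOSITION 4.5 on the order `T`: `type(T) + 1 = dim_{T/𝔓} 𝒪_K/𝔓`** for an order `T = 𝔯 ≠ 𝒪_K`
with a maximal ideal `𝔓` which is an `𝒪_K`-ideal (`type(T) = type_𝔓(T)`, §3, and `type_𝔓(T) + 1 = dim 𝒪_K/𝔓`,
§2); with `T = S + 𝔭𝒪_K`, `𝔓 = 𝔭𝒪_K`, `T/𝔓 = S/𝔭` this is the printed «`dim_{S/𝔭} 𝒪_K/𝔭𝒪_K = 1 + type(S + 𝔭𝒪_K)`».
[cite: Marseglia2024CMType, §4 Prop. 4.5, p. 10] -/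
theorem iSup_finrank_traceDual_quotient_add_one_eq_finrank_quotient_of_mul_coeIdeal_eq
    {M : FractionalIdeal (endOrder (Algebra.leftMulMatrix μ))⁰ K}
    (hMO : (M : Set K) = (algebraMap (𝓞 K) K).range) {𝔓 : Ideal (endOrder (Algebra.leftMulMatrix μ))}
    [h𝔓 : 𝔓.IsMaximal] (h𝔓M : M * 𝔓 = 𝔓) (hS : ∃ a : 𝓞 K, (a : K) ∉ endOrder (Algebra.leftMulMatrix μ))
    {T : FractionalIdeal (endOrder (Algebra.leftMulMatrix μ))⁰ K}
    (hT : (T : Submodule (endOrder (Algebra.leftMulMatrix μ)) K) =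
      traceDual ℤ ℚ ((1 : FractionalIdeal (endOrder (Algebra.leftMulMatrix μ))⁰ K) :
        Submodule (endOrder (Algebra.leftMulMatrix μ)) K)) :
    (⨆ 𝔮 : MaximalSpectrum (endOrder (Algebra.leftMulMatrix μ)),
        Module.finrank (endOrder (Algebra.leftMulMatrix μ) ⧸ 𝔮.asIdeal)
          ((T : Submodule (endOrder (Algebra.leftMulMatrix μ)) K) ⧸
            (𝔮.asIdeal • ⊤ : Submodule (endOrder (Algebra.leftMulMatrix μ))
              (T : Submodule (endOrder (Algebra.leftMulMatrix μ)) K)))) + 1 =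
      Module.finrank (endOrder (Algebra.leftMulMatrix μ) ⧸ 𝔓)
        ((M : Submodule (endOrder (Algebra.leftMulMatrix μ)) K) ⧸
          (𝔓 • ⊤ : Submodule (endOrder (Algebra.leftMulMatrix μ))
            (M : Submodule (endOrder (Algebra.leftMulMatrix μ)) K))) := by
  rw [iSup_finrank_traceDual_quotient_eq_of_mul_coeIdeal_eq μ hMO h𝔓M hS hT]
  exact finrank_traceDual_quotient_add_one_eq_finrank_quotient_of_mul_coeIdeal_eq μ hMO h𝔓M hS hT

end CMTypeLattice

end Literature.NumberTheory.ComplexMultiplication
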